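import Literature.AlgebraicGeometry.HodgeTheory.MiddleDimensionReductionComplexGysin
import Literature.AlgebraicGeometry.HodgeTheory.SupportedHodgeClassDescent
import Literature.AlgebraicGeometry.HodgeTheory.GysinKernelProofs
import Literature.AlgebraicGeometry.HodgeTheory.ThomGysinClosedImmersion
import Literature.AlgebraicGeometry.HodgeTheory.HardLefschetzNFold
import HarnessLib

/-!
# Reduction of the Hodge conjecture to the middle dimension (BFNP Lemma 48) from the lifting of Hodge classes along Gysin morphisms (Voisin 2025, Cor. 2.12)

Family `hodge`, layer `Literature/AlgebraicGeometry/HodgeTheory`. Third companion of the named fact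
`middleDimensionReduction` (file `MiddleDimensionReduction`; P. Brosnan, H. Fang, Z. Nie,
G. Pearlstein, *Singularities of admissible normal functions*, Invent. Math. 177 (2009), §6
**Lemma 48**, arXiv:0711.0964 p. 13, read in the materialised arXiv text, lines 28–66: "• The
Hodge conjecture holds for all smooth projective complex varieties `Y`. • For every smooth
projective complex variety `X` of dimension `2n` with `n ∈ ℤ`, `(Alg^n X)^⊥ = 0`" are equivalent;
proof: "Suppose then that `dim Y < 2k`. In this case, set `X = Y × ℙ^{2k − dim Y}` and let
`β = pr₁^* α` […] by the projection formula, `α ∪ pr_{1*}[Z] ≠ 0` […] Finally, suppose that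
`dim Y > 2k`. Since `Y` is projective, we can use Bertini to find a smooth subvariety `i : X ↪ Y`
which is the intersection of `dim Y − 2k` hyperplane sections. By weak Lefschetz, the restriction
map `i^* : H^{2k}(Y, ℚ(k)) → H^{2k}(X, ℚ(k))` is injective […] by the projection formula, it
follows that `α ∪ i_*[Z] ≠ 0`").

The printed proof runs through the perfect pairing `Hdg^k Y ⊗ Hdg^{dim Y − k} Y → ℚ` ((6.1), "By
Poincaré duality and the Hodge–Riemann bilinear relations"), i.e. through the polarisation of the
Hodge structures `H^{2k}(Y, ℚ)`. Read COVARIANTLY (transpose every map by Poincaré duality), the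
two halves say: a rational `(p,p)`-class `c ∈ H²ᵖ(Y(ℂ))` is `pr_{1*}` of a middle-degree class of
`Y × ℙ^{dim Y − 2p}` (`2p < dim Y`), resp. `i_*` of a middle-degree class of a smooth complete
intersection `X^{2(dim Y − p)} ⊂ Y` (`2p > dim Y`, weak Lefschetz), and the ONE Hodge-theoretic input
is that a Hodge class in the image of a Gysin morphism is the Gysin image of (a combination of)
Hodge classes — which is exactly what the polarisation gives: C. Voisin, *Hodge and generalized
Hodge conjectures, coniveau and algebraic cycles*, J. Open Math. Probl. 1 (2025), **Cor. 2.12**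
(p. 24): "Let `H, H′` be Hodge structures of weight `2k`, with `H′` polarized, and let `φ : H′ → H`
be a surjective morphism of Hodge structures. Then `φ : Hdg(H′) → Hdg(H)` is surjective. Indeed,
this follows from the fact that, thanks to Proposition 2.11 [the category of polarizable rational
Hodge structures is semi-simple = Voisin I, Lemma 7.26], `φ` has a left inverse as morphism of
Hodge structures", applied (as in the proofs of Prop. 3.8, p. 28, and Prop. 5.15, p. 45, ibid.) to
Gysin morphisms `φ = g_*` ("the Gysin morphism `φ_*` […] is a morphism of Hodge structures", §2.1
p. 23 = Voisin I §7.3.2). On the tree's carriers this is the EXISTING named fact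
`Voisin2025_hodgeClass_lift_complexGysin` (`HodgeTheory/GysinHodgeClassLift`), stated for the REAL
Gysin morphisms `complexGysin μ` (`HodgeTheory/ComplexGysin`) of every orientation family `μ` with
Poincaré duality — and Poincaré duality is a theorem of the tree
(`OrientationFamily.hasPoincareDuality`, Hatcher Thm. 3.30).

This file (library-first road; the companions `MiddleDimensionReductionProofs`,
`MiddleDimensionReductionComplexGysin`, `MiddleDimensionReductionOfHodgeModels` run the printed
contravariant argument and need Hodge models of the auxiliary varieties, the Hodge compatibility of
pull-backs / cup products / Gysin maps as separate inputs) PROVES, introducing no named fact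
(D-0026):

* `mem_algebraicClasses_of_two_mul_add_eq_of_hodgeClass_lift` — **the product half (`2p ≤ n`)
  from `Voisin2025_hodgeClass_lift_complexGysin` ALONE**: for the slice `s_t = (𝟙, t) : X ⟶ X × ℙʳ`
  (`n = 2p + r`), `c = (s_t ≫ pr₁)_* c = pr_{1*}(s_{t*} c)` (`complexGysin_comp`, `complexGysin_id`)
  lies in the image of `pr_{1*} : H^{2(p+r)}((X × ℙʳ)(ℂ)) → H²ᵖ(X(ℂ))` from the MIDDLE degree of the
  `2(p+r)`-fold `X × ℙʳ`; by Cor. 2.12, `c = pr_{1*} b` with `b` in the `ℂ`-span of the rational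
  `(p+r, p+r)`-classes, which are algebraic by the middle-dimensional hypothesis; and `pr_{1*}`
  maps `N^{p+r} H^{2(p+r)}` into `Nᵖ H²ᵖ` (`complexGysin_mem_algebraicClasses`, the PROVED support
  property `gysinMap_restrictCompl_eq_zero_of_field ℂ`, Fulton App. B §B.2 Ex. 5). No Hodge model of
  `X × ℙʳ`, no Hodge compatibility of `pr₁^*`, `pr_{1*}` or `∪` is assumed: Cor. 2.12 carries all of it.
* `mem_algebraicClasses_of_gap_of_hodgeClass_lift_of_weakLefschetz`,
  `mem_algebraicClasses_of_lt_two_mul_of_hodgeClass_lift_of_weakLefschetz` — **the section half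
  (`2p > n`) from `Voisin2025_hodgeClass_lift_complexGysin` and "Bertini + weak Lefschetz"**, the
  latter as the hypothesis `hWL`: every smooth projective variety `X` of dimension `m + 1` contains a
  smooth closed subvariety `i : Y ↪ X` of dimension `m` off which there is no homology above the
  complex dimension, `H_j((X ∖ Y)(ℂ); ℂ) = 0` for `j > m + 1` (a smooth hyperplane section:
  Bertini, Hartshorne II Thm. 8.18 with III Cor. 7.9.1; its complement is a smooth AFFINE variety,
  which "has the homotopy type of a CW-complex of dimension `≤ dim`", Andreotti–Frankel = Voisin II
  Thm. 1.22, whence weak Lefschetz, Thm. 1.23 — the tree proves this vanishing for hypersurface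
  complements in `ℙᴺ`, `HypersurfaceComplement.isZero_singularHomology_hypersurfaceComplement`, not
  yet for sections of a general `X`). Proof by induction on the gap `2p − n`: `H²ᵖ((X ∖ Y)(ℂ); ℂ) = 0`
  (universal coefficients over the field `ℂ`), so `c` dies off `Y` and `c = i_* y` by the tree's
  UNCONDITIONAL Thom–Gysin exactness for one smooth closed subvariety
  (`exists_complexGysin_eq_of_isClosedImmersion`, Voisin II §6.1.1); by Cor. 2.12, `c = i_* b` with
  `b` in the span of the rational `(p−1, p−1)`-classes of `Y`, whose gap is `2p − n − 1`; push forward.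
* `middleDimensionReduction_of_hodgeClass_lift_of_weakLefschetz` — **BFNP Lemma 48 from Cor. 2.12
  and Bertini–weak-Lefschetz** (the printed ingredients, covariantly);
  `middleDimensionReduction_of_hodgeClass_lift_of_hardLefschetz` — **from Cor. 2.12 and the named
  fact `nonempty_hardLefschetzNFold`** (the road of Thomas 2005 Prop. 2 / Kerr–Pearlstein 2011 §3.1
  above the middle: `c = L^{2p−n} c'`); `middleDimensionReduction_of_hodgeClass_lift_of_nonempty_hodgeModel`
  — from Cor. 2.12 and the named facts `hodgePQ_independent_of_hodgeModel`, `nonempty_hodgeModel`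
  (the `ℙ¹`-steps of `MiddleDimensionReductionComplexGysin` above the middle).

So the discharge `middleDimensionReduction_holds` is `Voisin2025_hodgeClass_lift_complexGysin_holds`
plus ONE of: `nonempty_hardLefschetzNFold` (all `n`, `X`), the pair (`hodgePQ_independent_of_hodgeModel`,
`nonempty_hodgeModel`), or Bertini + Andreotti–Frankel for hyperplane sections of smooth projective
varieties; below the middle it is Cor. 2.12 alone. None of these is discharged here (Cor. 2.12 is the
semisimplicity of polarised Hodge structures on `H^{2k}(X(ℂ), ℚ)` — Hodge–Riemann — which the tree
does not have on these carriers).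

## References

* [BrosnanFangNiePearlstein2009] P. Brosnan, H. Fang, Z. Nie, G. Pearlstein, Singularities of
  admissible normal functions, Invent. Math. 177 (2009), §6 (6.1) and Lemma 48 (arXiv:0711.0964, p. 13).
* [Voisin2025] C. Voisin, Hodge and generalized Hodge conjectures, coniveau and algebraic cycles,
  J. Open Math. Probl. 1 (2025) 16–51, §2.1 (p. 23), Prop. 2.11, Cor. 2.12 (p. 24), proofs of
  Prop. 3.8 (p. 28) and Prop. 5.15 (p. 45), Cor. 4.5 (p. 38).
* [VoisinHodgeI2002] C. Voisin, Hodge Theory and Complex Algebraic Geometry I, CUP 2002, Lemma 7.26,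
  §7.3.2, Thm. 6.25, Rem. 6.27.
* [VoisinHodgeII2003] C. Voisin, Hodge Theory and Complex Algebraic Geometry II, CUP 2003, §1.2.2
  Thm. 1.22–1.23 (Andreotti–Frankel, weak Lefschetz), §6.1.1 (Thom–Gysin sequence).
* [Hartshorne1977] R. Hartshorne, Algebraic Geometry, Springer 1977, II Thm. 8.18, III Cor. 7.9.1.
* [FultonYoungTableaux1997] W. Fulton, Young Tableaux, CUP 1997, App. B §B.1 (5), §B.2 Exercise 5.
* [KerrPearlstein2011] M. Kerr, G. Pearlstein, An exponential history of functions with logarithmic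
  growth, MSRI Publ. 58 (2011), §3.1.  * [Thomas2005Nodes] R. Thomas, Nodes and the Hodge
  conjecture, J. Algebraic Geom. 14 (2005), Prop. 2.  * [HatcherAT2002] A. Hatcher, Algebraic
  Topology, CUP 2002, Thm. 3.2, Thm. 3.30.
-/

noncomputable section

open CategoryTheory CategoryTheory.Limits AlgebraicGeometry MonoidalCategory CartesianMonoidalCategory
open Literature.AlgebraicTopology.SingularHomology

namespace Literature.AlgebraicGeometry.HodgeTheory

section HodgeTheory

/-! ### The product half from Cor. 2.12 alone -/

/-- **The product half of BFNP Lemma 48 (degrees `2p ≤ n`) from the lifting of Hodge classes along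
Gysin morphisms alone.** If rational Hodge classes in Gysin images lift to (spans of) rational Hodge
classes (`Voisin2025_hodgeClass_lift_complexGysin`, Voisin 2025 Cor. 2.12) and every rational
middle-degree Hodge class on every even-dimensional smooth projective complex variety is algebraic,
then on a smooth projective `X` of dimension `n = 2p + r` every rational `(p,p)`-class
`c ∈ H²ᵖ(X(ℂ); ℂ)` is algebraic: `c = pr_{1*}(s_{t*} c)` lies in the image of
`pr_{1*} : H^{2(p+r)}((X × ℙʳ)(ℂ)) → H²ᵖ(X(ℂ))` from the middle degree of the `2(p+r)`-fold `X × ℙʳ`,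
hence `c = pr_{1*} b` with `b` in the span of the rational `(p+r, p+r)`-classes (Cor. 2.12), which
are algebraic by hypothesis, and `pr_{1*}` maps algebraic classes to algebraic classes. In print:
"set `X = Y × ℙ^{2k − dim Y}` […] by the projection formula, `α ∪ pr_{1*}[Z] ≠ 0`", transposed.
[cite: BrosnanFangNiePearlstein2009, §6 Lemma 48 (proof, case dim Y < 2k)]
[cite: Voisin2025, Cor. 2.12 (p. 24) and proof of Prop. 3.8 (p. 28)]
[cite: FultonYoungTableaux1997, Appendix B §B.1 (5) and §B.2 Exercise 5] -/
theorem mem_algebraicClasses_of_two_mul_add_eq_of_hodgeClass_lift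
    (h : Voisin2025_hodgeClass_lift_complexGysin)
    (hmid : ∀ ⦃m : ℕ⦄ ⦃Y : Motives.SchemeOver ℂ⦄, Motives.IsSmoothProjective (2 * m) Y →
      ∀ c : complexBetti Y (2 * m), IsRationalClass c → IsOfHodgeType (2 * m) Y (2 * m) m m c →
        c ∈ algebraicClasses Y m)
    {n : ℕ} {X : Motives.SchemeOver ℂ} (hX : Motives.IsSmoothProjective n X) {p r : ℕ}
    (hr : 2 * p + r = n) (c : complexBetti X (2 * p)) (hc : IsRationalClass c)
    (hpp : IsOfHodgeType n X (2 * p) p p c) : c ∈ algebraicClasses X p := by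
  classical
  -- an orientation family (the closed manifolds `X(ℂ)` are orientable; the Gysin images below do
  -- not depend on the choice) and its Poincaré duality (a theorem of the tree)
  let μ : OrientationFamily := fun _ _ h ↦ Classical.choice (Motives.ComplexPoints.isOrientableOver ℂ h)
  have hμ : μ.HasPoincareDuality := μ.hasPoincareDuality
  -- the auxiliary factor `P = ℙʳ_ℂ`, a complex point `t` of it, and the smooth projective `X × P`
  set P := Motives.projectiveSpace r ℂ with hPdef
  have hP : Motives.IsSmoothProjective r P := Motives.isSmoothProjective_projectiveSpace_holds ℂ r
  haveI := connectedSpace_complexPoints hP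
  obtain ⟨t⟩ : Nonempty (Motives.ComplexPoints P) := inferInstance
  have hXP : Motives.IsSmoothProjective (n + r) (X ⊗ P) := Motives.IsSmoothProjective.tensor_holds hX hP
  -- `c = pr₁_* (s_* c)` lies in the image of `pr₁_*` from the middle degree `2 (p + r)` of `X × P`
  have hab : 2 * (p + r) + 2 * n = 2 * p + 2 * (n + r) := by ring
  have hsl : 2 * p + 2 * (n + r) = 2 * (p + r) + 2 * n := by ring
  have hcomp := complexGysin_comp hμ hX hXP hX (Motives.sliceAt X t) (fst X P) hsl hab
  rw [Motives.sliceAt_fst, complexGysin_id hμ hX] at hcomp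
  have hcrange : c ∈ LinearMap.range (complexGysin μ hXP hX (fst X P) hab) := by
    refine ⟨complexGysin μ hX hXP (Motives.sliceAt X t) hsl c, ?_⟩
    rw [← LinearMap.comp_apply, ← hcomp, LinearMap.id_apply]
  -- Cor. 2.12: `c = pr₁_* b`, `b` in the span of the rational middle-degree Hodge classes of `X × P`
  have hlift := h μ hμ hX (ι := Unit) (m := fun _ ↦ n + r) (Y := fun _ ↦ X ⊗ P) (fun _ ↦ hXP)
    (fun _ ↦ fst X P) p hc hpp
    (Submodule.mem_iSup_of_mem () (Submodule.mem_iSup_of_mem (2 * (p + r))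
      (Submodule.mem_iSup_of_mem hab hcrange)))
  refine SetLike.le_def.mp (iSup_le fun _ ↦ iSup_le fun d ↦ iSup_le fun hd ↦ ?_) hlift
  rw [Submodule.map_le_iff_le_comap, Submodule.span_le]
  rintro b ⟨hb, hb'⟩
  rw [SetLike.mem_coe, Submodule.mem_comap]
  -- `X × P` has the even dimension `n + r = 2 d` (`d = p + r`): `b` is algebraic by hypothesis
  have hd' : n + r = 2 * d := by omega
  have hXP' : Motives.IsSmoothProjective (2 * d) (X ⊗ P) := hd' ▸ hXP
  have hb'' : IsOfHodgeType (2 * d) (X ⊗ P) (2 * d) d d b := by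
    have hb₀ : IsOfHodgeType (n + r) (X ⊗ P) (2 * d) d d b := hb'
    rwa [hd'] at hb₀
  have halg : b ∈ algebraicClasses (X ⊗ P) d := hmid hXP' b hb hb''
  -- `pr₁_*` maps `N^d H^{2d}((X × P)(ℂ))` into `Nᵖ H²ᵖ(X(ℂ))`
  exact complexGysin_mem_algebraicClasses (gysinMap_restrictCompl_eq_zero_of_field ℂ) μ hμ hXP hX
    (fst X P) (by omega) hd halg

/-- **The Hodge conjecture in all degrees `2p ≤ dim X` from the Hodge conjecture in the middle
degree, granted Cor. 2.12** (`r = n − 2p`). [cite: BrosnanFangNiePearlstein2009, §6 Lemma 48]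
[cite: Voisin2025, Cor. 2.12 (p. 24)] -/
theorem mem_algebraicClasses_of_two_mul_le_of_hodgeClass_lift
    (h : Voisin2025_hodgeClass_lift_complexGysin)
    (hmid : ∀ ⦃m : ℕ⦄ ⦃Y : Motives.SchemeOver ℂ⦄, Motives.IsSmoothProjective (2 * m) Y →
      ∀ c : complexBetti Y (2 * m), IsRationalClass c → IsOfHodgeType (2 * m) Y (2 * m) m m c →
        c ∈ algebraicClasses Y m)
    {n : ℕ} {X : Motives.SchemeOver ℂ} (hX : Motives.IsSmoothProjective n X) {p : ℕ}
    (hp : 2 * p ≤ n) (c : complexBetti X (2 * p)) (hc : IsRationalClass c)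
    (hpp : IsOfHodgeType n X (2 * p) p p c) : c ∈ algebraicClasses X p :=
  mem_algebraicClasses_of_two_mul_add_eq_of_hodgeClass_lift h hmid hX (r := n - 2 * p) (by omega)
    c hc hpp

/-! ### The section half from Cor. 2.12 and Bertini–weak Lefschetz -/

/-- **The section half of BFNP Lemma 48 (degrees `2p > n`) from the lifting of Hodge classes along
Gysin morphisms and Bertini–weak Lefschetz.** Hypotheses: Cor. 2.12 (`h`); `hWL`: every smooth
projective variety `X` of dimension `m + 1` contains a smooth closed subvariety `i : Y ↪ X` of
dimension `m` with `H_j((X ∖ Y)(ℂ); ℂ) = 0` for all `j > m + 1` (a smooth hyperplane section, Bertini;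
its complement is smooth affine of dimension `m + 1`, so has the homotopy type of a CW-complex of
dimension `≤ m + 1`, Andreotti–Frankel / Voisin II Thm. 1.22 — the form in which weak Lefschetz,
Thm. 1.23, is proved there and in the tree for `ℙᴺ`); and the Hodge conjecture in the middle degree.
Conclusion, for every gap `g`: on a smooth projective `X` of dimension `n` with `n + g = 2p`, every
rational `(p,p)`-class `c ∈ H²ᵖ(X(ℂ); ℂ)` is algebraic. Induction on `g`: for `g = 0` this is the
hypothesis; for `g + 1`, either `p > n` and `c = 0` (`Hᵏ(X(ℂ)) = 0` for `k > 2n`), or `n = m + 1`,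
`H²ᵖ((X ∖ Y)(ℂ); ℂ) = 0` (universal coefficients over `ℂ`, `2p > m + 1`), so `c` dies off `Y` and
`c = i_* y` (Thom–Gysin exactness for the smooth closed subvariety `Y`,
`exists_complexGysin_eq_of_isClosedImmersion`, unconditional in the tree); by Cor. 2.12 `c = i_* b`
with `b` in the span of the rational `(p−1, p−1)`-classes of the `m`-fold `Y` (gap `g`), algebraic by
induction, and `i_*` maps algebraic classes to algebraic classes. In print: "we can use Bertini to
find a smooth subvariety `i : X ↪ Y` which is the intersection of `dim Y − 2k` hyperplane sections. By
weak Lefschetz, the restriction map `i^*` […] is injective […] `α ∪ i_*[Z] ≠ 0`", transposed and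
one hyperplane at a time. [cite: BrosnanFangNiePearlstein2009, §6 Lemma 48 (proof, case dim Y > 2k)]
[cite: Voisin2025, Cor. 2.12 (p. 24) and proof of Prop. 3.8 (p. 28)]
[cite: VoisinHodgeII2003, §1.2.2 Thm. 1.22–1.23 and §6.1.1] [cite: Hartshorne1977, II Thm. 8.18] -/
theorem mem_algebraicClasses_of_gap_of_hodgeClass_lift_of_weakLefschetz
    (h : Voisin2025_hodgeClass_lift_complexGysin)
    (hWL : ∀ ⦃m : ℕ⦄ ⦃X : Motives.SchemeOver ℂ⦄, Motives.IsSmoothProjective (m + 1) X →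
      ∃ (Y : Motives.SchemeOver ℂ) (_ : Motives.IsSmoothProjective m Y) (i : Y ⟶ X)
        (_ : IsClosedImmersion i.left), ∀ j : ℕ, m + 1 < j →
          IsZero (singularHomology ℂ ℂ (Motives.complexPointsCompl X (Set.range i.left.base)) j))
    (hmid : ∀ ⦃m : ℕ⦄ ⦃Y : Motives.SchemeOver ℂ⦄, Motives.IsSmoothProjective (2 * m) Y →
      ∀ c : complexBetti Y (2 * m), IsRationalClass c → IsOfHodgeType (2 * m) Y (2 * m) m m c →
        c ∈ algebraicClasses Y m) :
    ∀ (g : ℕ) {n : ℕ} {X : Motives.SchemeOver ℂ} (_ : Motives.IsSmoothProjective n X) {p : ℕ}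
      (_ : n + g = 2 * p) (c : complexBetti X (2 * p)), IsRationalClass c →
        IsOfHodgeType n X (2 * p) p p c → c ∈ algebraicClasses X p
  | 0, n, X, hX, p, hg, c, hc, hpp =>
    mem_algebraicClasses_of_two_mul_add_eq_of_hodgeClass_lift h hmid hX (r := 0) (by omega) c hc hpp
  | g + 1, n, X, hX, p, hg, c, hc, hpp => by
    classical
    -- above twice the dimension there are no classes
    by_cases hpn : n < p
    · haveI := subsingleton_complexBetti hX (show 2 * n < 2 * p by omega)
      rw [Subsingleton.elim c 0]
      exact Submodule.zero_mem _
    -- so `n = m + 1` and `p = p' + 1`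
    obtain ⟨m, rfl⟩ : ∃ m, n = m + 1 := ⟨n - 1, by omega⟩
    obtain ⟨p', rfl⟩ : ∃ p', p = p' + 1 := ⟨p - 1, by omega⟩
    let μ : OrientationFamily :=
      fun _ _ h ↦ Classical.choice (Motives.ComplexPoints.isOrientableOver ℂ h)
    have hμ : μ.HasPoincareDuality := μ.hasPoincareDuality
    -- a smooth closed `Y ⊆ X` of dimension `m` off which there is no homology above degree `m + 1`
    obtain ⟨Y, hY, i, hi, hAF⟩ := hWL hX
    haveI := hi
    -- `c` dies on `(X ∖ Y)(ℂ)`: `H^{2p}((X ∖ Y)(ℂ); ℂ) ↪ Hom(H_{2p}, ℂ) = 0`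
    have hc0 : complexBetti.restrictCompl X (Set.range i.left.base) (2 * (p' + 1)) c = 0 := by
      haveI := ModuleCat.subsingleton_of_isZero (hAF (2 * (p' + 1)) (by omega))
      haveI := (kroneckerPairing_injective_of_field ℂ
        (Motives.complexPointsCompl X (Set.range i.left.base)) (2 * (p' + 1))).subsingleton
      exact Subsingleton.elim _ _
    -- Thom–Gysin: `c = i_* y`
    have hab : 2 * p' + 2 * (m + 1) = 2 * (p' + 1) + 2 * m := by ring
    obtain ⟨y, hy⟩ := exists_complexGysin_eq_of_isClosedImmersion μ hX hY i hab hc0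
    -- Cor. 2.12: `c = i_* b`, `b` in the span of the rational `(p', p')`-classes of `Y`
    have hlift := h μ hμ hX (ι := Unit) (m := fun _ ↦ m) (Y := fun _ ↦ Y) (fun _ ↦ hY)
      (fun _ ↦ i) (p' + 1) hc hpp
      (Submodule.mem_iSup_of_mem () (Submodule.mem_iSup_of_mem (2 * p')
        (Submodule.mem_iSup_of_mem hab ⟨y, hy⟩)))
    refine SetLike.le_def.mp (iSup_le fun _ ↦ iSup_le fun d ↦ iSup_le fun hd ↦ ?_) hlift
    rw [Submodule.map_le_iff_le_comap, Submodule.span_le]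
    rintro b ⟨hb, hb'⟩
    rw [SetLike.mem_coe, Submodule.mem_comap]
    obtain rfl : d = p' := by omega
    -- induction (gap `g` on the `m`-fold `Y`), then push forward
    have halg : b ∈ algebraicClasses Y d :=
      mem_algebraicClasses_of_gap_of_hodgeClass_lift_of_weakLefschetz h hWL hmid g hY (by omega) b hb hb'
    exact complexGysin_mem_algebraicClasses (gysinMap_restrictCompl_eq_zero_of_field ℂ) μ hμ hY hX i
      (by omega) hd halg

/-- **The Hodge conjecture in degrees `2p > dim X` from the Hodge conjecture in the middle degree,
granted Cor. 2.12 and Bertini–weak Lefschetz** (gap `g = 2p − n`).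
[cite: BrosnanFangNiePearlstein2009, §6 Lemma 48 (proof, case dim Y > 2k)] [cite: Voisin2025, Cor. 2.12 (p. 24)]
[cite: VoisinHodgeII2003, §1.2.2 Thm. 1.22–1.23] -/
theorem mem_algebraicClasses_of_lt_two_mul_of_hodgeClass_lift_of_weakLefschetz
    (h : Voisin2025_hodgeClass_lift_complexGysin)
    (hWL : ∀ ⦃m : ℕ⦄ ⦃X : Motives.SchemeOver ℂ⦄, Motives.IsSmoothProjective (m + 1) X →
      ∃ (Y : Motives.SchemeOver ℂ) (_ : Motives.IsSmoothProjective m Y) (i : Y ⟶ X)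
        (_ : IsClosedImmersion i.left), ∀ j : ℕ, m + 1 < j →
          IsZero (singularHomology ℂ ℂ (Motives.complexPointsCompl X (Set.range i.left.base)) j))
    (hmid : ∀ ⦃m : ℕ⦄ ⦃Y : Motives.SchemeOver ℂ⦄, Motives.IsSmoothProjective (2 * m) Y →
      ∀ c : complexBetti Y (2 * m), IsRationalClass c → IsOfHodgeType (2 * m) Y (2 * m) m m c →
        c ∈ algebraicClasses Y m)
    {n : ℕ} {X : Motives.SchemeOver ℂ} (hX : Motives.IsSmoothProjective n X) {p : ℕ}
    (hnp : n < 2 * p) (c : complexBetti X (2 * p)) (hc : IsRationalClass c)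
    (hpp : IsOfHodgeType n X (2 * p) p p c) : c ∈ algebraicClasses X p :=
  mem_algebraicClasses_of_gap_of_hodgeClass_lift_of_weakLefschetz h hWL hmid (2 * p - n) hX (by omega)
    c hc hpp

/-! ### The named fact from Cor. 2.12 and one Lefschetz-type input -/

/-- **BFNP Lemma 48 from the lifting of Hodge classes along Gysin morphisms (Voisin 2025 Cor. 2.12)
and Bertini–weak Lefschetz** — the printed ingredients, read covariantly: below the middle
`c = pr_{1*}(s_{t*} c)` on `X × ℙ^{n − 2p}`, above the middle hyperplane sections, Thom–Gysin and
Andreotti–Frankel; in both halves Cor. 2.12 supplies the Hodge classes upstairs and Gysin images of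
algebraic classes are algebraic. [cite: BrosnanFangNiePearlstein2009, §6 Lemma 48]
[cite: Voisin2025, Cor. 2.12 (p. 24)] [cite: VoisinHodgeII2003, §1.2.2 Thm. 1.22–1.23 and §6.1.1] -/
theorem middleDimensionReduction_of_hodgeClass_lift_of_weakLefschetz
    (h : Voisin2025_hodgeClass_lift_complexGysin)
    (hWL : ∀ ⦃m : ℕ⦄ ⦃X : Motives.SchemeOver ℂ⦄, Motives.IsSmoothProjective (m + 1) X →
      ∃ (Y : Motives.SchemeOver ℂ) (_ : Motives.IsSmoothProjective m Y) (i : Y ⟶ X)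
        (_ : IsClosedImmersion i.left), ∀ j : ℕ, m + 1 < j →
          IsZero (singularHomology ℂ ℂ (Motives.complexPointsCompl X (Set.range i.left.base)) j)) :
    middleDimensionReduction := by
  intro hmid n X hX p c hc hpp
  rcases Nat.lt_or_ge n (2 * p) with hlt | hle
  · exact mem_algebraicClasses_of_lt_two_mul_of_hodgeClass_lift_of_weakLefschetz h hWL hmid hX hlt c
      hc hpp
  · exact mem_algebraicClasses_of_two_mul_le_of_hodgeClass_lift h hmid hX hle c hc hpp

/-- **BFNP Lemma 48 from the lifting of Hodge classes along Gysin morphisms (Voisin 2025 Cor. 2.12)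
and hard Lefschetz** (the named fact `nonempty_hardLefschetzNFold`, Voisin I Thm. 6.25 / Rem. 6.27;
the road of Thomas 2005 Prop. 2 and Kerr–Pearlstein 2011 §3.1 above the middle): degrees `2p ≤ n` by
`mem_algebraicClasses_of_two_mul_le_of_hodgeClass_lift`, degrees `2p > n` by
`mem_algebraicClasses_of_lt_of_nonempty` (`c = L^{2p−n} c'` with `c'` a rational `(n−p, n−p)`-class
of degree `2(n−p) < n`, algebraic by the product half). [cite: BrosnanFangNiePearlstein2009, §6 Lemma 48]
[cite: Voisin2025, Cor. 2.12 (p. 24)] [cite: VoisinHodgeI2002, Thm. 6.25, Rem. 6.27 and Lemma 7.26]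
[cite: KerrPearlstein2011, §3.1] -/
theorem middleDimensionReduction_of_hodgeClass_lift_of_hardLefschetz
    (h : Voisin2025_hodgeClass_lift_complexGysin)
    (hHL : ∀ (n : ℕ) (X : Motives.SchemeOver ℂ), nonempty_hardLefschetzNFold n X) :
    middleDimensionReduction := by
  intro hmid n X hX p c hc hpp
  rcases Nat.lt_or_ge n (2 * p) with hlt | hle
  · exact mem_algebraicClasses_of_lt_of_nonempty (hHL n X) hX hlt
      (fun c' hc' hpp' ↦ mem_algebraicClasses_of_two_mul_le_of_hodgeClass_lift h hmid hX (by omega)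
        c' hc' hpp') c hc hpp
  · exact mem_algebraicClasses_of_two_mul_le_of_hodgeClass_lift h hmid hX hle c hc hpp

/-- **BFNP Lemma 48 from the lifting of Hodge classes along Gysin morphisms (Voisin 2025 Cor. 2.12)
and the named facts `hodgePQ_independent_of_hodgeModel`, `nonempty_hodgeModel`**: degrees `2p ≤ n`
by `mem_algebraicClasses_of_two_mul_le_of_hodgeClass_lift`, degrees `2p > n` by the `ℙ¹`-steps of
`mem_algebraicClasses_of_le_two_mul_of_nonempty_hodgeModel` (`c = s_t^* pr₁^* c` on `X × ℙ¹`,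
pull-backs preserve Hodge types by `preservesHodgeType_of_nonempty_hodgeModel`).
[cite: BrosnanFangNiePearlstein2009, §6 Lemma 48] [cite: Voisin2025, Cor. 2.12 (p. 24)]
[cite: VoisinHodgeI2002, §7.3.2] -/
theorem middleDimensionReduction_of_hodgeClass_lift_of_nonempty_hodgeModel
    (h : Voisin2025_hodgeClass_lift_complexGysin) (hI : hodgePQ_independent_of_hodgeModel)
    (hM : ∀ (m : ℕ) (Y : Motives.SchemeOver ℂ), nonempty_hodgeModel m Y) :
    middleDimensionReduction := by
  intro hmid n X hX p c hc hpp
  rcases Nat.lt_or_ge n (2 * p) with hlt | hle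
  · exact mem_algebraicClasses_of_le_two_mul_of_nonempty_hodgeModel hI hM hmid hX hlt.le c hc hpp
  · exact mem_algebraicClasses_of_two_mul_le_of_hodgeClass_lift h hmid hX hle c hc hpp

end HodgeTheory

end Literature.AlgebraicGeometry.HodgeTheory

end
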